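import Mathlib
import Summits.Ventures.PercRepro2.Defs
import Summits.Ventures.PercRepro2.Graph
import Summits.Ventures.PercRepro2.OneColourSwitch
import Summits.Ventures.PercRepro2.RegionHubSign
import Summits.Ventures.PercRepro2.SideSwitch
import Summits.Ventures.PercRepro2.SideSwitchFibre
import Summits.Ventures.PercRepro2.SideSwitchClosed
import Summits.Ventures.PercRepro2.SideSwitchComps
import Summits.Ventures.PercRepro2.SideSwitchCompsFibre
import Summits.Ventures.PercRepro2.M9NoPocketDefs
import Summits.Ventures.PercRepro2.M9NoPocketSetDefs
import Summits.Ventures.PercRepro2.M9NoPocketSetWorld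
import Summits.Ventures.PercRepro2.M9NoPocketSetWorldD
import Summits.Ventures.PercRepro2.M9NoPocketSetLegal

/-!
# The multi-`d` class without pockets — the fibration (blind cell PercRepro2, p3 g20,
2026-08-27; `proofs/P3-CPNC.md` §17i (2))

The multi-`d` form of `M9NoPocketFibre`: the `Sep`-colourings doubly reached only inside `D`
are fibred over the representatives by the legal coordinate vectors
(`sum_dSub_eq_sum_repD_L4`).  Own work; std axioms.
-/

namespace Summit.Ventures.PercRepro2

namespace NoPocketSet

open Finset Classical RegionHub OneColourSwitch SideSwitch NoPocket

variable {V : Type*} {E : Type*}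

section Fibre

variable [Fintype V] [DecidableEq V] [Fintype E] [DecidableEq E]

variable {ends : E → Sym2 V}

omit [Fintype V] [DecidableEq V] [Fintype E] in
/-- `flipF` commutes with `flipTouch`. -/
lemma flipF_flipTouch_comm (F : Finset E) (S : Set V) (ω : Config E) :
    flipF F (flipTouch ends S ω) = flipTouch ends S (flipF F ω) := by
  funext e
  by_cases hF : e ∈ F <;> by_cases hS : e ∈ touches ends S <;>
    simp [flipF_of_mem, flipF_of_notMem, flipTouch_of_mem, flipTouch_of_notMem, hF, hS]

omit [Fintype V] in
/-- Off the edges at `d`, a block switch composed with a `T`-edge flip is the block switch of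
`G − d`. -/
lemma flipTouch_flipF_eq_endsD_of_notMem {D : Finset V} {r s : V} {F : Finset E}
    (hF : F ⊆ Tset ends D r s) (S : Set V) (ω : Config E) {e : E} (he : ¬ AtD ends D e) :
    flipTouch ends S (flipF F ω) e = flipTouch (endsD ends D r) S ω e := by
  simp only [flipTouch, mem_touches_endsD_iff he, flipF_Tset_of_not_atD hF he]

omit [Fintype V] [DecidableEq V] [Fintype E] [DecidableEq E] in
/-- `Sep` in `G` gives `Sep` in `G − d`. -/
lemma sep2_endsD_of_sep2 {p q r s : V} {D : Finset V} {ω : Config E} (h : sep2 ends p q r s ω) :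
    sep2 (endsD ends D r) p q r s ω := by
  obtain ⟨⟨hpK, hqK⟩, ⟨hpM, hqM⟩⟩ := sep2_iff.1 h
  rw [sep2_iff]
  exact ⟨⟨fun h' => hpK (K2_endsD_subset_K2 ω h'), fun h' => hqK (K2_endsD_subset_K2 ω h')⟩,
    ⟨fun h' => hpM (M2_endsD_subset_M2 ω h'), fun h' => hqM (M2_endsD_subset_M2 ω h')⟩⟩

omit [Fintype V] [DecidableEq V] [Fintype E] [DecidableEq E] in
/-- Doubly reached only at `d` in `G` gives no doubly reached vertex in `G − d`. -/
lemma DZero_endsD_of_DSub {r s : V} {D : Finset V} (hDr : ∀ d ∈ D, d ≠ r)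
    (hDs : ∀ d ∈ D, d ≠ s) {ω : Config E} (h : DSub ends r s D ω) :
    DZero (endsD ends D r) r s ω := by
  intro y hyr hys hyK hyM
  have hyD : y ∉ D := fun hyD => not_mem_K2_endsD hyD (hDr y hyD) (hDs y hyD) ω hyK
  exact h y hyr hys hyD (K2_endsD_subset_K2 ω hyK) (M2_endsD_subset_M2 ω hyM)

/-- The `W`-coloured `T`-edges of a colouring. -/
noncomputable def wT (ends : E → Sym2 V) (D : Finset V) (r s : V) (ω : Config E) : Finset E :=
  (Tset ends D r s).filter (fun e => ω e = false)

/-- `repOf` unfolded. -/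
lemma repOf_eq {D : Finset V} {r s : V} (ω : Config E) :
    repOf (ends := ends) D r s ω =
      flipTouch ends (↑(Bside (endsD ends D r) r s ω) : Set V) (flipF (wT ends D r s ω) ω) := rfl

omit [DecidableEq E] in
/-- `coordsOf` unfolded. -/
lemma coordsOf_eq {D : Finset V} {r s : V} (ω : Config E) :
    coordsOf (ends := ends) D r s ω =
      ((blocks ends D r s ω).filter (fun C => C ⊆ Bside (endsD ends D r) r s ω),
        wT ends D r s ω) := rfl

omit [Fintype V] [DecidableEq E] in
/-- The `W`-coloured `T`-edges form a set of `T`-edges. -/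
lemma wT_subset {D : Finset V} {r s : V} (ω : Config E) : wT ends D r s ω ⊆ Tset ends D r s :=
  Finset.filter_subset _ _

omit [DecidableEq E] in
/-- No `T`-edge touches the `W`-side of `G − d`. -/
lemma Tset_not_touches_Bside {D : Finset V} {r s : V} (hDr : ∀ d ∈ D, d ≠ r)
    (hDs : ∀ d ∈ D, d ≠ s) (ω : Config E) {e : E} (he : e ∈ Tset ends D r s) :
    e ∉ touches ends (↑(Bside (endsD ends D r) r s ω) : Set V) := by
  rintro ⟨y, hy, z, hyz⟩
  obtain ⟨hyM, hyr, hys⟩ := mem_Bside.1 (Finset.mem_coe.1 hy)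
  have hyD : y ∉ D := fun h => not_mem_M2_endsD h (hDr y h) (hDs y h) ω hyM
  obtain ⟨d, hd, h⟩ := mem_Tset.1 he
  rcases h with h | h <;> rw [hyz, Sym2.eq_iff] at h
  · rcases h with ⟨h1, _⟩ | ⟨h1, _⟩
    · exact hyD (h1 ▸ hd)
    · exact hyr h1
  · rcases h with ⟨h1, _⟩ | ⟨h1, _⟩
    · exact hyD (h1 ▸ hd)
    · exact hys h1

/-- The worlds of `G − d` of the representative of a colouring doubly reached only at `d`. -/
lemma K2_endsD_repOf {p q r s : V} {D : Finset V} (hDr : ∀ d ∈ D, d ≠ r) (hDs : ∀ d ∈ D, d ≠ s) {ω : Config E}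
    (hω : ω ∈ DSubSet ends p q r s D) :
    K2 (endsD ends D r) r s (repOf (ends := ends) D r s ω) =
      (K2 (endsD ends D r) r s ω \ (↑(Bside (endsD ends D r) r s ω) : Set V)) ∪
        ((↑(Bside (endsD ends D r) r s ω) : Set V) ∩ M2 (endsD ends D r) r s ω) := by
  obtain ⟨hsep, hD⟩ := mem_DSubSet.1 hω
  have hsep' := sep2_endsD_of_sep2 (D := D) hsep
  have hD' := DZero_endsD_of_DSub hDr hDs hD
  rw [repOf_eq, K2_endsD_eq_of_eqOn (fun e he =>
    flipTouch_flipF_eq_endsD_of_notMem (wT_subset ω) _ ω he) s]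
  obtain ⟨hC, hCr, hCs⟩ := subset_U2_of_subset_A0 (Bside_subset_A0 (ends := endsD ends D r) r s ω)
  exact K2_flipTouch_of_closed hsep' hC hCr hCs (closedIn_Bside hsep' hD')

/-- The `W`-world of `G − d` of the representative of a colouring doubly reached only at `d`. -/
lemma M2_endsD_repOf {p q r s : V} {D : Finset V} (hDr : ∀ d ∈ D, d ≠ r) (hDs : ∀ d ∈ D, d ≠ s) {ω : Config E}
    (hω : ω ∈ DSubSet ends p q r s D) :
    M2 (endsD ends D r) r s (repOf (ends := ends) D r s ω) =
      (M2 (endsD ends D r) r s ω \ (↑(Bside (endsD ends D r) r s ω) : Set V)) ∪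
        ((↑(Bside (endsD ends D r) r s ω) : Set V) ∩ K2 (endsD ends D r) r s ω) := by
  obtain ⟨hsep, hD⟩ := mem_DSubSet.1 hω
  have hsep' := sep2_endsD_of_sep2 (D := D) hsep
  have hD' := DZero_endsD_of_DSub hDr hDs hD
  rw [repOf_eq, M2_endsD_eq_of_eqOn (fun e he =>
    flipTouch_flipF_eq_endsD_of_notMem (wT_subset ω) _ ω he) s]
  obtain ⟨hC, hCr, hCs⟩ := subset_U2_of_subset_A0 (Bside_subset_A0 (ends := endsD ends D r) r s ω)
  exact M2_flipTouch_of_closed hsep' hC hCr hCs (closedIn_Bside hsep' hD')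

/-- The representative of a colouring doubly reached only at `d` is a representative. -/
lemma repOf_mem_RepD {p q r s : V} {D : Finset V} (hDr : ∀ d ∈ D, d ≠ r) (hDs : ∀ d ∈ D, d ≠ s) {ω : Config E}
    (hω : ω ∈ DSubSet ends p q r s D) : repOf (ends := ends) D r s ω ∈ RepD ends p q r s D := by
  obtain ⟨hsep, hD⟩ := mem_DSubSet.1 hω
  have hsep' := sep2_endsD_of_sep2 (D := D) hsep
  have hD' := DZero_endsD_of_DSub hDr hDs hD
  rw [mem_RepD]
  refine ⟨?_, ?_, ?_⟩
  · rw [sep2_iff, K2_endsD_repOf hDr hDs hω, M2_endsD_repOf hDr hDs hω]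
    obtain ⟨⟨hpK, hqK⟩, ⟨hpM, hqM⟩⟩ := sep2_iff.1 hsep'
    have hpB : p ∉ (↑(Bside (endsD ends D r) r s ω) : Set V) := fun h =>
      hpM (mem_Bside.1 (Finset.mem_coe.1 h)).1
    have hqB : q ∉ (↑(Bside (endsD ends D r) r s ω) : Set V) := fun h =>
      hqM (mem_Bside.1 (Finset.mem_coe.1 h)).1
    refine ⟨⟨?_, ?_⟩, ⟨?_, ?_⟩⟩
    · rintro (⟨h, _⟩ | ⟨h, _⟩)
      · exact hpK h
      · exact hpB h
    · rintro (⟨h, _⟩ | ⟨h, _⟩)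
      · exact hqK h
      · exact hqB h
    · rintro (⟨h, _⟩ | ⟨h, _⟩)
      · exact hpM h
      · exact hpB h
    · rintro (⟨h, _⟩ | ⟨h, _⟩)
      · exact hqM h
      · exact hqB h
  · intro y hy
    rw [M2_endsD_repOf hDr hDs hω] at hy
    rcases hy with ⟨hyM, hyB⟩ | ⟨hyB, hyK⟩
    · by_contra h
      exact hyB (Finset.mem_coe.2 (mem_Bside.2
        ⟨hyM, fun h1 => h (Or.inl h1), fun h2 => h (Or.inr h2)⟩))
    · obtain ⟨hyM, hyr, hys⟩ := mem_Bside.1 (Finset.mem_coe.1 hyB)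
      exact (hD' y hyr hys hyK hyM).elim
  · intro e he
    rw [repOf_eq, flipTouch_of_notMem ends (Tset_not_touches_Bside hDr hDs ω he)]
    by_cases h : ω e = false
    · have hmem : e ∈ wT ends D r s ω := Finset.mem_filter.2 ⟨he, h⟩
      rw [flipF_of_mem hmem, h]; rfl
    · have hmem : e ∉ wT ends D r s ω := fun h' => h (Finset.mem_filter.1 h').2
      rw [flipF_of_notMem hmem]
      simpa using h

/-- The blocks of the representative of a colouring doubly reached only at `d` are its blocks. -/
lemma blocks_repOf {p q r s : V} {D : Finset V} (hDr : ∀ d ∈ D, d ≠ r) (hDs : ∀ d ∈ D, d ≠ s) {ω : Config E}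
    (hω : ω ∈ DSubSet ends p q r s D) :
    blocks ends D r s (repOf (ends := ends) D r s ω) = blocks ends D r s ω := by
  obtain ⟨hsep, hD⟩ := mem_DSubSet.1 hω
  have hsep' := sep2_endsD_of_sep2 (D := D) hsep
  have hD' := DZero_endsD_of_DSub hDr hDs hD
  obtain ⟨hC, hCr, hCs⟩ := subset_U2_of_subset_A0 (Bside_subset_A0 (ends := endsD ends D r) r s ω)
  have h1 : A0 (endsD ends D r) r s (repOf (ends := ends) D r s ω) =
      A0 (endsD ends D r) r s (flipTouch (endsD ends D r) (↑(Bside (endsD ends D r) r s ω) : Set V) ω) :=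
    A0_endsD_eq_of_eqOn (fun e he => by
      rw [repOf_eq]; exact flipTouch_flipF_eq_endsD_of_notMem (wT_subset ω) _ ω he) s
  have h2 : A0 (endsD ends D r) r s
      (flipTouch (endsD ends D r) (↑(Bside (endsD ends D r) r s ω) : Set V) ω) =
      A0 (endsD ends D r) r s ω := by
    ext y
    simp only [mem_A0]
    rw [U2_flipTouch_of_closed hsep' hC hCr hCs (closedIn_Bside hsep' hD')]
  simp only [blocks, comps, h1, h2]

/-- The `W`-side of `G − d` of a colouring doubly reached only at `d` is the union of its
`B`-side blocks. -/
lemma unionT_coords_eq_Bside {p q r s : V} {D : Finset V} (hDr : ∀ d ∈ D, d ≠ r) (hDs : ∀ d ∈ D, d ≠ s) {ω : Config E}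
    (hω : ω ∈ DSubSet ends p q r s D) :
    unionT (coordsOf (ends := ends) D r s ω).1 = Bside (endsD ends D r) r s ω := by
  obtain ⟨hsep, hD⟩ := mem_DSubSet.1 hω
  exact unionT_filter_Bside (sep2_endsD_of_sep2 (D := D) hsep) (DZero_endsD_of_DSub hDr hDs hD)

/-- A colouring doubly reached only at `d` is the assignment of its coordinates to its
representative. -/
lemma assignX_coordsOf_repOf {p q r s : V} {D : Finset V} (hDr : ∀ d ∈ D, d ≠ r) (hDs : ∀ d ∈ D, d ≠ s) {ω : Config E}
    (hω : ω ∈ DSubSet ends p q r s D) :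
    assignX ends (coordsOf (ends := ends) D r s ω) (repOf (ends := ends) D r s ω) = ω := by
  rw [assignX, unionT_coords_eq_Bside hDr hDs hω, coordsOf_eq, repOf_eq]
  simp only
  rw [flipF_flipTouch_comm, flipTouch_flipTouch, flipF_flipF]

/-- The `W`-side of `G − d` of an assignment is the switched union. -/
lemma Bside_endsD_assignX {p q r s : V} {D : Finset V} {ρ : Config E} (hρ : ρ ∈ RepD ends p q r s D)
    {x : Finset (Finset V) × Finset E} (hT : x.1 ⊆ blocks ends D r s ρ)
    (hF : x.2 ⊆ Tset ends D r s) :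
    Bside (endsD ends D r) r s (assignX ends x ρ) = unionT x.1 := by
  obtain ⟨_, hM', _⟩ := mem_RepD.1 hρ
  ext y
  rw [mem_Bside, M2_endsD_assignX hρ hT hF]
  constructor
  · rintro ⟨(hyM | hyT), hyr, hys⟩
    · rcases hM' y hyM with h | h
      · exact (hyr h).elim
      · exact (hys h).elim
    · exact Finset.mem_coe.1 hyT
  · intro hyT
    have hyA := unionT_subset_A0 (ends := endsD ends D r) hT hyT
    obtain ⟨_, hyr, hys⟩ := mem_A0.1 hyA
    exact ⟨Or.inr (Finset.mem_coe.2 hyT), hyr, hys⟩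

/-- The coordinates of an assignment are the assigned vector. -/
lemma coordsOf_assignX {p q r s : V} {D : Finset V} (hDr : ∀ d ∈ D, d ≠ r) (hDs : ∀ d ∈ D, d ≠ s) {ρ : Config E}
    (hρ : ρ ∈ RepD ends p q r s D) {x : Finset (Finset V) × Finset E}
    (hT : x.1 ⊆ blocks ends D r s ρ) (hF : x.2 ⊆ Tset ends D r s) :
    coordsOf (ends := ends) D r s (assignX ends x ρ) = x := by
  rw [coordsOf_eq, Bside_endsD_assignX hρ hT hF, blocks_assignX hρ hT hF]
  simp only [blocks]
  rw [filter_subset_unionT (ends := endsD ends D r) hT]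
  refine Prod.ext rfl ?_
  simp only [wT]
  ext e
  rw [Finset.mem_filter]
  constructor
  · rintro ⟨he, h⟩
    exact (assignX_Tset_eq_false_iff hρ hDr hDs hT he).1 h
  · intro he
    exact ⟨hF he, (assignX_Tset_eq_false_iff hρ hDr hDs hT (hF he)).2 he⟩

/-- The representative of an assignment is the representative. -/
lemma repOf_assignX {p q r s : V} {D : Finset V} (hDr : ∀ d ∈ D, d ≠ r) (hDs : ∀ d ∈ D, d ≠ s) {ρ : Config E}
    (hρ : ρ ∈ RepD ends p q r s D) {x : Finset (Finset V) × Finset E}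
    (hT : x.1 ⊆ blocks ends D r s ρ) (hF : x.2 ⊆ Tset ends D r s) :
    repOf (ends := ends) D r s (assignX ends x ρ) = ρ := by
  have hc := coordsOf_assignX hDr hDs hρ hT hF
  rw [coordsOf_eq] at hc
  have h2 : wT ends D r s (assignX ends x ρ) = x.2 := congrArg Prod.snd hc
  rw [repOf_eq, Bside_endsD_assignX hρ hT hF, h2, assignX, flipF_flipTouch_comm,
    flipTouch_flipTouch, flipF_flipF]

/-- **The fibration**: the `Sep`-colourings doubly reached only at `d` are the legal
assignments of the representatives, each exactly once. -/
theorem sum_dSub_eq_sum_repD_L4 {p q r s : V} {D : Finset V} (hnp : NoPocketAt ends D r s)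
    (hind : DIndep ends D) (hpD : p ∉ D) (hqD : q ∉ D) (hDr : ∀ d ∈ D, d ≠ r)
    (hDs : ∀ d ∈ D, d ≠ s) (f : Config E → ℤ) :
    ∑ ω ∈ DSubSet ends p q r s D, f ω =
      ∑ ρ ∈ RepD ends p q r s D, ∑ x ∈ L4 ends D r s ρ, f (assignX ends x ρ) := by
  have hmaps : ∀ ω ∈ DSubSet ends p q r s D, repOf (ends := ends) D r s ω ∈ RepD ends p q r s D :=
    fun ω hω => repOf_mem_RepD hDr hDs hω
  rw [← Finset.sum_fiberwise_of_maps_to hmaps]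
  refine Finset.sum_congr rfl (fun ρ hρ => ?_)
  refine Finset.sum_nbij' (fun ω => coordsOf (ends := ends) D r s ω) (fun x => assignX ends x ρ)
    ?_ ?_ ?_ ?_ ?_
  · intro ω hω
    rw [Finset.mem_filter] at hω
    obtain ⟨hωD, hωρ⟩ := hω
    have hT : (coordsOf (ends := ends) D r s ω).1 ⊆ blocks ends D r s (repOf (ends := ends) D r s ω) := by
      rw [blocks_repOf hDr hDs hωD, coordsOf_eq]
      exact Finset.filter_subset _ _
    have hx := mem_L4_of_mem_DSubSet_assignX hDr hDs (repOf_mem_RepD hDr hDs hωD) hT (wT_subset ω)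
      (by rw [assignX_coordsOf_repOf hDr hDs hωD]; exact hωD)
    rw [hωρ] at hx
    exact hx
  · intro x hx
    rw [Finset.mem_filter]
    obtain ⟨⟨hT, hF⟩, _⟩ := mem_L4.1 hx
    exact ⟨mem_DSubSet_assignX_of_mem_L4 hnp hind hpD hqD hDr hDs hρ hx, repOf_assignX hDr hDs hρ hT hF⟩
  · intro ω hω
    rw [Finset.mem_filter] at hω
    obtain ⟨hωD, hωρ⟩ := hω
    rw [← hωρ]
    exact assignX_coordsOf_repOf hDr hDs hωD
  · intro x hx
    obtain ⟨⟨hT, hF⟩, _⟩ := mem_L4.1 hx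
    exact coordsOf_assignX hDr hDs hρ hT hF
  · intro ω hω
    rw [Finset.mem_filter] at hω
    obtain ⟨hωD, hωρ⟩ := hω
    rw [← hωρ, assignX_coordsOf_repOf hDr hDs hωD]

end Fibre

end NoPocketSet

end Summit.Ventures.PercRepro2
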